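import Summits.BirchSwinnertonDyer.BirchSwinnertonDyer.Theorems.ManinLocalTwoThreeManinPrimeToAdditiveFiveLeAcrossIsogenyOneModTwelve
import Summits.BirchSwinnertonDyer.Rank1Residual.Additive.GordIsogenyInvarianceClasses
import Summits.BirchSwinnertonDyer.Rank1Residual.Additive.TypeGRamification
import Summits.BirchSwinnertonDyer.Rank1Residual.Additive.PotentiallyOrdinaryTypeG
import Literature.NumberTheory.EllipticCurves.PastenHeightBoundsLemma68LocalProofs
import Literature.NumberTheory.EllipticCurves.IsogenyPotentiallyGoodMinimalDiscriminantProofs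
import Literature.NumberTheory.EllipticCurves.IsogenyPotentiallyGoodOrdinaryMinimalDiscriminant
import Literature.NumberTheory.EllipticCurves.IsogenyDegreeOneProofs
import Literature.NumberTheory.EllipticCurves.IsogenyVariableChangeProofs
import Literature.NumberTheory.EllipticCurves.GlobalMinimalModelProofs
import HarnessLib

/-!
# Route `ManinLocalTwoThree`, residual crux C5 `ManinPrimeToAdditiveFiveLe` (stmt-BirchSwinnertonDyer-22969),
# line `upper_anchor`, skeleton of record v13 (stub `stub_printedInputs`, 7th conjunct): **the printed input
# `dokchitser_padicValInt_minimalDiscriminantInt_eq_of_isogeny_of_potentiallyGoodOrdinary` (Dokchitser–Dokchitser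
# 2015 Thm. 5.1 (1), clause `l = p`, "potentially ordinary") is a THEOREM at every `p ≥ 5`** — more precisely on the
# whole Delbourgo (G)-locus `e ∣ p − 1`, hence unconditionally at every `p ≡ 1 (mod 12)`

Width seat bsd-line-ml23-c5-p1-w2 (gen 6). THEOREMS ONLY (no definition, no named fact, no `sorry`).

WHAT. For a prime `p ≥ 5`, globally minimal elliptic curves `W ∼ W'` over `ℚ` (ANY `ℚ`-isogeny), `W` additive
at `p` and of Delbourgo type (G) at `p` (good reduction over a subfield of `ℚ(ζ_p)`; by the tree's dictionary
`typeG_iff_not_subM_and_semistabilityIndex_dvd` this is `ord_p j ≥ 0 ∧ e ∣ p − 1`, `e = 12 / gcd(12, ord_p Δ_min)`):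
**`ord_p Δ_min(W) = ord_p Δ_min(W')`** (`padicValInt_minimalDiscriminantInt_eq_of_isIsogenous_of_typeG`). This
sharpens the b2b cell's `padicValInt_minimalDiscriminantInt_eq_or_add_eq_twelve_of_isIsogenous_of_typeG`
("`= v` or the two add up to `12`": the Kodaira type moves at most II ↔ II*, III ↔ III*, IV ↔ IV*) to
EQUALITY — the swap never occurs on the (G)-locus, which that file's docstring records as "IN PRINT (not typed
here)" (Dokchitser–Dokchitser 2015 Cor. 8 / Thm. 22). Corollaries: the (G)-ORDINARY form
(`…_of_typeGOrd`), the shape of the cite-only named fact at `p ≥ 5` on the additive locus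
(`…_of_isIsogenous_of_potentiallyGoodOrdinary_of_five_le`, hypothesis
`HasPotentiallyGoodOrdinaryReductionAtPrime` verbatim), and the UNCONDITIONAL form at `p ≡ 1 (mod 12)`
(`…_of_isIsogenous_of_mod_twelve_eq_one`: there `e ∣ 12 ∣ p − 1` for every potentially good fibre), which
supersedes gen 5's prime-degree lemma `padicValInt_minimalDiscriminantInt_eq_of_degree_prime_of_mod_twelve`.

HOW (Dokchitser–Dokchitser's own route, §3: Thm. 6 = Coates' congruence, then Cor. 8; no reduction of isogenies
modulo `w`, no separability of `φ̃` — the obstruction recorded in the fact file's "WHY NOT A THEOREM YET"):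
1. PRIME STEP (`…_of_degree_prime_of_typeG`). For a `ℚ`-isogeny `ψ : W → V` of prime degree `ℓ` between
   globally minimal curves: if `ℓ ≠ p`, the DISCHARGED clause `l ≠ p`
   (`dokchitser_padicValInt_minimalDiscriminantInt_eq_of_isogeny_of_not_dvd_degree_holds`); if `ℓ = p`, COATES
   (`padicValInt_minimalDiscriminantInt_modEq_twelve_of_degree_prime`, PROVED from Vélu): `δ_V ≡ p·δ_W = δ_W +
   (p − 1)·δ_W ≡ δ_W (mod 12)` because `12 ∣ (p − 1)·δ_W` on the (G)-locus (`twelve_dvd_of_typeG`), and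
   `δ_W, δ_V ∈ {2, 3, 4, 6, 8, 9, 10}` (both additive potentially good: `Addv.of_isIsogenous_of_typeG`,
   `padicValRat_j_nonneg_of_isIsogenous_of_typeG`, `padicValInt_minimalDiscriminantInt_mem_of_addv_of_padicValRat_j_nonneg`).
2. CYCLIC INDUCTION (`…_of_isCyclic_of_typeG`), strong induction on the degree `n` of a CYCLIC `ℚ`-isogeny:
   `n = 1` is a change of variables between globally minimal models (`exists_variableChange_eq_of_degree_eq_one`,
   `minimalDiscriminantInt_smul_eq_holds`); for `n > 1` peel a prime step `φ = λ ∘ ψ`, `deg ψ = ℓ = minFac n`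
   (`exists_isCyclic_factor_of_dvd`, Silverman *AEC* III.4.11–4.12), move the intermediate curve to a global
   minimal model (`hasGlobalMinimalModel_rat_holds`, the degree-one isogeny `VariableChange.toIsogeny` and
   `Isogeny.exists_eq_comp_of_ker_le`), apply the prime step and the induction hypothesis — type (G) and additivity
   are CLASS invariants (`TypeG.of_isIsogenous`, `Addv.of_isIsogenous_of_typeG`).
3. ANY isogeny is cyclic after a multiplication map (`Isogeny.exists_isCyclic_degree_dvd`, *AEC* III.4.11).

USE ON THE C5 LINE. The single-book core at `13` (`EisensteinTrichotomy.index_dichotomy_of_strongIsTop` /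
`not_dvd_c_of_notBottom_of_strongIsTop`, pub/bsd-wall ttd-p1) takes the named fact as the hypothesis `hDD` and
uses it once, at `p = 13`, on a (G)-ordinary additive `V ∼ W₀`: that instance is `…_of_typeGOrd` below (at
`13 ≡ 1 (mod 12)` even `…_of_mod_twelve_eq_one`). The sequel file re-keys the core on this theorem, so that the
v13 single TFMD book of C5 needs FOUR prints {F″, EdK, EdG, MazurJ}, not five.

HONEST STATUS: `--supports 22969` helper; unconditional theorems; nothing here proves C5, the TFMD items, Manin's
conjecture or BSD. The named fact itself (all primes, incl. `p = 2, 3`, non-additive fibres) stays a `def`.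

References: [DokchitserDokchitser2015LocalInvariants] §2 Thm. 3 (Coates), §3 Thm. 6, Thm. 7, Cor. 8, §5 Thm. 5.1 (1);
[SilvermanAEC2009] III.4.11, III.4.12, VII.5.5, Cor. VII.7.2, VIII.8.3; [SilvermanATAEC1994] IV Table 4.1;
[Serre1972] §5.6; [Delbourgo1998] §1.5 (hypothesis (G)).
-/

set_option autoImplicit false
-- the Theorems namespace of this sub repeats the summit name by design (D-0017 nested layout)
set_option linter.dupNamespace false

noncomputable section

open scoped Classical NumberField

namespace Summit.BirchSwinnertonDyer.BirchSwinnertonDyer.Theorems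

open WeierstrassCurve IsDedekindDomain IsDedekindDomain.HeightOneSpectrum Rat.HeightOneSpectrum NumberField
  Literature.NumberTheory.EllipticCurves Literature.NumberTheory.EllipticCurves.ModularForms
  Literature.NumberTheory.EllipticCurves.Rank1Residual
  Literature.NumberTheory.DiophantineGeometry
  Summit.BirchSwinnertonDyer.Rank1Residual
  Summit.BirchSwinnertonDyer.Rank1Residual.ManinAdditive
  Summit.BirchSwinnertonDyer.Rank1Residual.Additive

/-! ## §1 The prime step -/

/-- **Prime step.** `ψ : W → V` a `ℚ`-isogeny of PRIME degree `ℓ` between globally minimal elliptic curves,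
`p ≥ 5`, `W` additive at `p` of Delbourgo type (G): `ord_p Δ_min(W) = ord_p Δ_min(V)`. For `ℓ ≠ p` this is the
discharged clause `l ≠ p` of Dokchitser–Dokchitser Thm. 5.1 (1); for `ℓ = p` Coates' congruence
`δ_V ≡ p·δ_W (mod 12)` with `12 ∣ (p − 1)·δ_W` (type (G)) and `δ_W, δ_V ∈ {2,3,4,6,8,9,10}`.
[cite: DokchitserDokchitser2015LocalInvariants, §3 Thm. 6 and Cor. 8] [cite: SilvermanATAEC1994, IV Table 4.1] -/
theorem padicValInt_minimalDiscriminantInt_eq_of_degree_prime_of_typeG {p : ℕ} [hpF : Fact p.Prime]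
    (hp5 : 5 ≤ p) {W V : WeierstrassCurve ℚ} [W.IsElliptic] [W.IsGloballyMinimal] [V.IsElliptic]
    [V.IsGloballyMinimal] (ψ : Isogeny W V) {ℓ : ℕ} (hℓ : ℓ.Prime) (hdeg : ψ.degree = ℓ)
    (hadd : Addv W p) (hG : TypeG W p) :
    padicValInt p W.minimalDiscriminantInt = padicValInt p V.minimalDiscriminantInt := by
  have hp : p.Prime := hpF.out
  have hj : 0 ≤ padicValRat p W.j := padicValRat_j_nonneg_of_typeG W p hG
  by_cases hℓp : ℓ = p
  · subst hℓp
    have hiso : IsIsogenous W V := ⟨ψ⟩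
    have haddV : Addv V ℓ := Addv.of_isIsogenous_of_typeG hadd hG hiso
    have hjV : 0 ≤ padicValRat ℓ V.j := padicValRat_j_nonneg_of_isIsogenous_of_typeG hG hiso
    have hmem := padicValInt_minimalDiscriminantInt_mem_of_addv_of_padicValRat_j_nonneg W ℓ hp5 hadd hj
    have hmemV := padicValInt_minimalDiscriminantInt_mem_of_addv_of_padicValRat_j_nonneg V ℓ hp5 haddV hjV
    -- Coates: `ℓ·δ_W ≡ δ_V (mod 12)`
    have hmod := padicValInt_minimalDiscriminantInt_modEq_twelve_of_degree_prime ψ hp hp5 hdeg ℓ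
    rw [Int.modEq_iff_dvd] at hmod
    -- type (G): `12 ∣ (ℓ − 1)·δ_W`
    have h12 : (12 : ℤ) ∣ ((ℓ : ℤ) - 1) * (padicValInt ℓ W.minimalDiscriminantInt : ℤ) := by
      have h := twelve_dvd_of_typeG W ℓ hG
      rwa [← cast_minimalDiscriminantInt W, padicValRat.of_int] at h
    -- with both valuations in `{2,3,4,6,8,9,10}` the two divisibilities force equality
    have key : ∀ a b : ℕ, (a = 2 ∨ a = 3 ∨ a = 4 ∨ a = 6 ∨ a = 8 ∨ a = 9 ∨ a = 10) →
        (b = 2 ∨ b = 3 ∨ b = 4 ∨ b = 6 ∨ b = 8 ∨ b = 9 ∨ b = 10) →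
        (12 : ℤ) ∣ (b : ℤ) - (ℓ : ℤ) * (a : ℤ) → (12 : ℤ) ∣ ((ℓ : ℤ) - 1) * (a : ℤ) → a = b := by
      intro a b ha hb h1 h2
      rcases ha with rfl | rfl | rfl | rfl | rfl | rfl | rfl <;>
        rcases hb with rfl | rfl | rfl | rfl | rfl | rfl | rfl <;> push_cast at h1 h2 ⊢ <;> omega
    exact key _ _ hmem hmemV hmod h12
  · exact dokchitser_padicValInt_minimalDiscriminantInt_eq_of_isogeny_of_not_dvd_degree_holds W V ψ p hp
      (by rw [hdeg]; exact fun h ↦ hℓp ((Nat.prime_dvd_prime_iff_eq hp hℓ).mp h).symm) hj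

/-! ## §2 Cyclic isogenies: strong induction on the degree -/

/-- **Cyclic induction.** For a CYCLIC `ℚ`-isogeny `φ : W → W'` of degree `n` between globally minimal elliptic
curves, `p ≥ 5`, `W` additive at `p` of type (G): `ord_p Δ_min(W) = ord_p Δ_min(W')`. Degree `1` is a change of
variables between globally minimal models; otherwise peel a prime step through a global minimal model of the
intermediate quotient and use §1 and the induction hypothesis (type (G) and additivity are class invariants).
[cite: SilvermanAEC2009, Cor. III.4.11 and Prop. III.4.12, Cor. VIII.8.3]
[cite: DokchitserDokchitser2015LocalInvariants, §3 Cor. 8] -/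
theorem padicValInt_minimalDiscriminantInt_eq_of_isCyclic_of_typeG {p : ℕ} [Fact p.Prime] (hp5 : 5 ≤ p)
    (n : ℕ) :
    ∀ {W W' : WeierstrassCurve ℚ} [W.IsElliptic] [W.IsGloballyMinimal] [W'.IsElliptic] [W'.IsGloballyMinimal]
      (φ : Isogeny W W'), φ.IsCyclic → φ.degree = n → Addv W p → TypeG W p →
        padicValInt p W.minimalDiscriminantInt = padicValInt p W'.minimalDiscriminantInt := by
  induction n using Nat.strong_induction_on with
  | _ n ih =>
    intro W W' _ _ _ _ φ hφ hdeg hadd hG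
    by_cases h1 : n = 1
    · -- degree one: a change of variables between two globally minimal models
      subst h1
      obtain ⟨C, hC⟩ := φ.exists_variableChange_eq_of_degree_eq_one hdeg
      subst hC
      exact congrArg (padicValInt p) (minimalDiscriminantInt_smul_eq_holds W C).symm
    · have hn0 : n ≠ 0 := by rw [← hdeg]; exact φ.degree_pos.ne'
      -- a prime factor `ℓ` of `n` and the factorisation `φ = λ ∘ ψ`, `deg ψ = ℓ`
      set ℓ := n.minFac with hℓdef
      have hℓ : ℓ.Prime := Nat.minFac_prime h1
      have hℓn : ℓ ∣ n := Nat.minFac_dvd n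
      obtain ⟨W'', hW'', ψ, lam, -, hψdeg, hlamcyc, hlamdeg⟩ :=
        exists_isCyclic_factor_of_dvd φ hφ (hdeg ▸ hℓn)
      haveI := hW''
      -- a global minimal model `V = C • W''` of the intermediate curve
      obtain ⟨C, hCmin⟩ := hasGlobalMinimalModel_rat_holds W''
      haveI := hCmin
      set ι : Isogeny W'' (C • W'') := VariableChange.toIsogeny W'' C with hιdef
      -- `ψ' = ι ∘ ψ : W → V`, still of degree `ℓ`
      set ψ' : Isogeny W (C • W'') := ι.comp ψ with hψ'def
      have hψ'deg : ψ'.degree = ℓ := by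
        rw [← hψdeg]
        unfold Isogeny.degree
        rw [hψ'def, Isogeny.ker_comp, hιdef, VariableChange.ker_toIsogeny, AddMonoidHom.comap_bot]
      -- `λ = λ' ∘ ι` with `λ' : V → W'`
      have hιker : ∀ P : W''.geomPoints, ι P = 0 → lam P = 0 := by
        intro P hP
        have hP0 : P = 0 := VariableChange.toIsogeny_injective W'' C (by rw [hP, map_zero])
        rw [hP0, map_zero]
      have hιsep : ι.deg ≤ Nat.card ι.toAddMonoidHom.ker := by
        rw [← Isogeny.degree_eq_deg]; exact le_rfl
      obtain ⟨lam', hlam'⟩ := ι.exists_eq_comp_of_ker_le lam hιsep hιker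
      have hcomp : lam.toAddMonoidHom = lam'.toAddMonoidHom.comp ι.toAddMonoidHom := by
        ext P; exact hlam' P
      -- `deg λ' = deg λ`
      have hι1 : Nat.card ι.toAddMonoidHom.ker = 1 := by
        rw [hιdef]; exact VariableChange.degree_toIsogeny W'' C
      have hlam'deg : lam'.degree = lam.degree := by
        unfold Isogeny.degree
        rw [hcomp, AddMonoidHom.natCard_ker_comp_of_surjective _ _ ι.surjective, hι1, mul_one]
      -- `λ'` is cyclic: `ker λ' = ι(ker λ)`
      have hkerlam' : lam'.toAddMonoidHom.ker = lam.toAddMonoidHom.ker.map ι.toAddMonoidHom := by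
        ext Q
        simp only [AddMonoidHom.mem_ker, AddSubgroup.mem_map]
        constructor
        · intro hQ
          obtain ⟨P, rfl⟩ := ι.surjective Q
          exact ⟨P, by rw [Isogeny.coe_toAddMonoidHom, hlam' P]; exact hQ, rfl⟩
        · rintro ⟨P, hP, rfl⟩
          rw [Isogeny.coe_toAddMonoidHom, hlam' P] at hP
          exact hP
      have hlam'cyc : lam'.IsCyclic := by
        haveI : IsAddCyclic lam.toAddMonoidHom.ker := hlamcyc
        change IsAddCyclic lam'.toAddMonoidHom.ker
        rw [hkerlam']
        exact isAddCyclic_of_surjective _ (AddMonoidHom.addSubgroupMap_surjective ι.toAddMonoidHom _)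
      -- degrees: `deg λ' = n / ℓ < n`
      have hlt : lam'.degree < n := by
        rw [hlam'deg]
        have h : lam.degree * ℓ = n := by rw [hlamdeg, hdeg]
        have hℓ1 : 1 < ℓ := hℓ.one_lt
        have hpos : 0 < lam.degree := lam.degree_pos
        nlinarith
      -- the prime step and the induction hypothesis
      have hiso : IsIsogenous W (C • W'') := ⟨ψ'⟩
      have hstep := padicValInt_minimalDiscriminantInt_eq_of_degree_prime_of_typeG hp5 ψ' hℓ hψ'deg hadd hG
      have hrest := ih lam'.degree hlt lam' hlam'cyc rfl (Addv.of_isIsogenous_of_typeG hadd hG hiso)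
        (hG.of_isIsogenous hiso)
      exact hstep.trans hrest

/-! ## §3 Every isogeny; the (G)-ordinary, Dokchitser–Dokchitser and `p ≡ 1 (mod 12)` forms -/

/-- **Dokchitser–Dokchitser 2015 Thm. 5.1 (1) on the (G)-locus, `p ≥ 5`, EVERY `ℚ`-isogeny.** `W ∼ W'` globally
minimal elliptic curves over `ℚ`, `W` additive at `p ≥ 5` of Delbourgo type (G) (`ord_p j ≥ 0`, `e ∣ p − 1`):
`ord_p Δ_min(W) = ord_p Δ_min(W')` — the Kodaira type at `p` is CONSTANT on the class (the swap II ↔ II*,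
III ↔ III*, IV ↔ IV* allowed by `padicValInt_minimalDiscriminantInt_eq_or_add_eq_twelve_of_isIsogenous_of_typeG`
never occurs). Any isogeny is a cyclic one after a multiplication map (*AEC* III.4.11), then §2.
[cite: DokchitserDokchitser2015LocalInvariants, §3 Cor. 8 and §5 Thm. 5.1 (1)] [cite: SilvermanAEC2009, Cor. III.4.11] -/
theorem padicValInt_minimalDiscriminantInt_eq_of_isIsogenous_of_typeG {p : ℕ} [Fact p.Prime] (hp5 : 5 ≤ p)
    {W W' : WeierstrassCurve ℚ} [W.IsElliptic] [W.IsGloballyMinimal] [W'.IsElliptic] [W'.IsGloballyMinimal]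
    (h : IsIsogenous W W') (hadd : Addv W p) (hG : TypeG W p) :
    padicValInt p W.minimalDiscriminantInt = padicValInt p W'.minimalDiscriminantInt := by
  obtain ⟨φ⟩ := h
  obtain ⟨ψ, hψ, -⟩ := φ.exists_isCyclic_degree_dvd
  exact padicValInt_minimalDiscriminantInt_eq_of_isCyclic_of_typeG hp5 ψ.degree ψ hψ rfl hadd hG

/-- **The (G)-ORDINARY form** (the hypothesis shape of the C5 / TFMD core at `13`: `TypeGOrd`).
[cite: DokchitserDokchitser2015LocalInvariants, §3 Cor. 8] -/
theorem padicValInt_minimalDiscriminantInt_eq_of_isIsogenous_of_typeGOrd {p : ℕ} [Fact p.Prime] (hp5 : 5 ≤ p)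
    {W W' : WeierstrassCurve ℚ} [W.IsElliptic] [W.IsGloballyMinimal] [W'.IsElliptic] [W'.IsGloballyMinimal]
    (h : IsIsogenous W W') (hadd : Addv W p) (hGo : TypeGOrd W p) :
    padicValInt p W.minimalDiscriminantInt = padicValInt p W'.minimalDiscriminantInt :=
  padicValInt_minimalDiscriminantInt_eq_of_isIsogenous_of_typeG hp5 h hadd hGo.typeG

/-- **Dokchitser–Dokchitser 2015 Thm. 5.1 (1), clause `l = p` "potentially ordinary", as a THEOREM at every
`p ≥ 5` on the additive locus** — the cite-only named fact
`dokchitser_padicValInt_minimalDiscriminantInt_eq_of_isogeny_of_potentiallyGoodOrdinary` with its hypothesis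
`HasPotentiallyGoodOrdinaryReductionAtPrime` VERBATIM, restricted to `5 ≤ p` and `W` additive at `p` (the shape in
which every consumer in the tree applies it: `p = 13` on the TFMD/C5 core, `p ≥ 11` on the AKR Manin frames).
Potentially good ordinary at an additive `p ≥ 5` is (G)-ordinary (`typeGOrd_iff_exists_good_unitRoot`).
[cite: DokchitserDokchitser2015LocalInvariants, §5 Thm. 5.1 (1) with §3 Cor. 8] [cite: Serre1972, §5.6] -/
theorem padicValInt_minimalDiscriminantInt_eq_of_isIsogenous_of_potentiallyGoodOrdinary_of_five_le {p : ℕ}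
    [Fact p.Prime] (hp5 : 5 ≤ p) {W W' : WeierstrassCurve ℚ} [W.IsElliptic] [W.IsGloballyMinimal]
    [W'.IsElliptic] [W'.IsGloballyMinimal] (h : IsIsogenous W W') (hadd : Addv W p)
    (hord : W.HasPotentiallyGoodOrdinaryReductionAtPrime p) :
    padicValInt p W.minimalDiscriminantInt = padicValInt p W'.minimalDiscriminantInt :=
  padicValInt_minimalDiscriminantInt_eq_of_isIsogenous_of_typeGOrd hp5 h hadd
    ((typeGOrd_iff_exists_good_unitRoot W p hp5 hadd).mpr hord)

/-- **Unconditional at `p ≡ 1 (mod 12)`** (in particular `p = 13`): for `W ∼ W'` globally minimal, `W`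
additive and potentially good at `p` (`ord_p j ≥ 0`), `ord_p Δ_min(W) = ord_p Δ_min(W')` — every potentially good
fibre is of type (G) there (`e ∣ 12 ∣ p − 1`, `typeG_iff_padicValRat`). Supersedes gen 5's prime-degree
`padicValInt_minimalDiscriminantInt_eq_of_degree_prime_of_mod_twelve`.
[cite: DokchitserDokchitser2015LocalInvariants, §3 Thm. 7 and Cor. 8] -/
theorem padicValInt_minimalDiscriminantInt_eq_of_isIsogenous_of_mod_twelve_eq_one {p : ℕ} [hpF : Fact p.Prime]
    (hp12 : p % 12 = 1) {W W' : WeierstrassCurve ℚ} [W.IsElliptic] [W.IsGloballyMinimal] [W'.IsElliptic]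
    [W'.IsGloballyMinimal] (h : IsIsogenous W W') (hadd : Addv W p) (hj : 0 ≤ padicValRat p W.j) :
    padicValInt p W.minimalDiscriminantInt = padicValInt p W'.minimalDiscriminantInt := by
  have hp : p.Prime := hpF.out
  have hp5 : 5 ≤ p := by have := hp.two_le; omega
  refine padicValInt_minimalDiscriminantInt_eq_of_isIsogenous_of_typeG hp5 h hadd
    ((typeG_iff_padicValRat W p hp5).mpr ⟨hj, ?_⟩)
  obtain ⟨q, rfl⟩ : ∃ q : ℕ, p = 12 * q + 1 := ⟨p / 12, by omega⟩
  refine ⟨(q : ℤ) * padicValRat (12 * q + 1) W.Δ, ?_⟩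
  push_cast
  ring

/-! ## §4 (appended) The named fact's exact shape at `p ≥ 5`: no additivity hypothesis -/

/-- **Dokchitser–Dokchitser 2015 Thm. 5.1 (1), clause `l = p` "the reduction is good or potentially ordinary", at every
`p ≥ 5` — the cite-only named fact `dokchitser_padicValInt_minimalDiscriminantInt_eq_of_isogeny_of_potentiallyGoodOrdinary` with its
binders VERBATIM plus the single extra hypothesis `5 ≤ p`** (no additivity clause): for `W ∼ W'` globally minimal elliptic curves over `ℚ`
and `W` of potentially good ORDINARY reduction at `p`, `ord_p Δ_min(W) = ord_p Δ_min(W')`. Additive fibre: §3. Otherwise `W` is GOOD at `p`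
(potentially good gives `ord_p j ≥ 0`, `HasPotentiallyGoodOrdinaryReductionAtPrime.padicValRat_j_nonneg`, while a multiplicative fibre has
`ord_p j < 0`, `EisensteinPrimes.padicValRat_j_neg_of_mult`), so is `W'` (Silverman *AEC* VII.7.2, `hasGoodReductionAtPrime_iff_of_isIsogenous`),
and both minimal discriminants are `p`-units (`not_dvd_minimalDiscriminantInt_of_hasGoodReductionAtPrime'`). The clause at `p ∈ {2, 3}`
(quadratic twists of good ordinary curves, loc. cit.) is not typed.
[cite: DokchitserDokchitser2015LocalInvariants, §5 Thm. 5.1 (1) with §3 Cor. 8] [cite: SilvermanAEC2009, VII.5.1, Cor. VII.7.2] -/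
theorem padicValInt_minimalDiscriminantInt_eq_of_isIsogenous_of_potentiallyGoodOrdinary_of_five_le' {p : ℕ}
    [hpF : Fact p.Prime] (hp5 : 5 ≤ p) {W W' : WeierstrassCurve ℚ} [W.IsElliptic] [W.IsGloballyMinimal]
    [W'.IsElliptic] [W'.IsGloballyMinimal] (h : IsIsogenous W W')
    (hord : W.HasPotentiallyGoodOrdinaryReductionAtPrime p) :
    padicValInt p W.minimalDiscriminantInt = padicValInt p W'.minimalDiscriminantInt := by
  by_cases hadd : Addv W p
  · exact padicValInt_minimalDiscriminantInt_eq_of_isIsogenous_of_potentiallyGoodOrdinary_of_five_le hp5 h hadd hord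
  · -- not additive: good at `p` (multiplicative is excluded by `ord_p j ≥ 0`), hence so is `W'`
    have hj : 0 ≤ padicValRat p W.j := hord.padicValRat_j_nonneg hpF.out
    have hgood : W.HasGoodReductionAtPrime p := by
      by_contra hng
      have hmult : W.HasMultiplicativeReductionAtPrime p := by
        by_contra hnm
        exact hadd ⟨hng, hnm⟩
      exact absurd (EisensteinPrimes.padicValRat_j_neg_of_mult W p hmult) (not_lt.mpr hj)
    have hgood' : W'.HasGoodReductionAtPrime p := (hasGoodReductionAtPrime_iff_of_isIsogenous h p).mp hgood
    rw [padicValInt.eq_zero_of_not_dvd (not_dvd_minimalDiscriminantInt_of_hasGoodReductionAtPrime' W p hgood),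
      padicValInt.eq_zero_of_not_dvd (not_dvd_minimalDiscriminantInt_of_hasGoodReductionAtPrime' W' p hgood')]

/-- **The named fact BY SHAPE at `p ≥ 5`**: the statement of
`dokchitser_padicValInt_minimalDiscriminantInt_eq_of_isogeny_of_potentiallyGoodOrdinary` with `5 ≤ p` inserted after `p.Prime` — so a
consumer holding `(hDD : dokchitser_…)` and using it only at primes `≥ 5` (the TFMD/C5 `13`-core, the AKR Manin frames at `p ≥ 11`) can take
this theorem instead, argument for argument. [cite: DokchitserDokchitser2015LocalInvariants, §5 Thm. 5.1 (1)] -/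
theorem dokchitser_padicValInt_minimalDiscriminantInt_eq_of_isogeny_of_potentiallyGoodOrdinary_of_five_le :
    ∀ (W W' : WeierstrassCurve ℚ) [W.IsElliptic] [W'.IsElliptic] [W.IsGloballyMinimal]
      [W'.IsGloballyMinimal] (p : ℕ), p.Prime → 5 ≤ p → IsIsogenous W W' →
      W.HasPotentiallyGoodOrdinaryReductionAtPrime p →
      padicValInt p W.minimalDiscriminantInt = padicValInt p W'.minimalDiscriminantInt := by
  intro W W' _ _ _ _ p hp hp5 h hord
  haveI : Fact p.Prime := ⟨hp⟩
  exact padicValInt_minimalDiscriminantInt_eq_of_isIsogenous_of_potentiallyGoodOrdinary_of_five_le' hp5 h hord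

end Summit.BirchSwinnertonDyer.BirchSwinnertonDyer.Theorems

end
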